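import Summits.Ventures.LatticeQCDFlow.Scoring.ParityLegBernsteinConfidence
import Summits.Ventures.LatticeQCDFlow.Scoring.ParityLegConfidenceColumns
import Literature.Probability.Moments.BennettBernsteinMeasure
import HarnessLib

/-!
# The ESS column from model draws: a two-sided, variance-adaptive certificate for
# `1/ESS = ∫ p²/q` with no parity hypothesis, and the A-vs-B comparison

HONEST FRAMING: exact (Metropolis-corrected) sampling algorithms for lattice gauge theory;
figures of merit are autocorrelation/cost numbers at stated couplings and volumes; no
continuum-physics claim.

Venture `LatticeQCDFlow` (cell pub-lqcd), topic `Scoring`; FANOUT row 4 (`s0-u1-b`, rung S0-B: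
two independent codes compared column by column).  Companion of `Scoring/PairedDrawAcceptance.lean`
(the acceptance column certified from paired model draws, no parity hypothesis): here the
reweighting column.  The population effective-sample-size fraction of a flow with normalised
target `p` and model `q > 0` is `ESS = 1/M₂`, `M₂ = ∫ p²/q dμ = E_q w²` (`w = p/q`;
`Exactness/FlowESSTargetSideParity`: `M₂ ≥ 1`).  `M₂` is the model mean of the score
`F = w² ∈ [0, W²]` under a weight ceiling `p ≤ Wq`, and `F` is self-bounding (`F² ≤ W²F`), so from
`n` independent model draws `yᵢ` with empirical mean `F̄ = (1/n)Σ w(yᵢ)²`: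
* ABOVE (`Scoring/ParityLegBernsteinConfidence`, Maurer's lower tail + inversion):
  `M₂ < F̄ + √(2W²a·F̄) + 2W²a` with confidence `1 − e^{−na}`;
* BELOW (Bernstein, tree `Literature…BennettBernsteinMeasure`, variance proxy `W²M₂`, inverted):
  `M₂ > F̄ − W²a/3 − √((W²a/3)² + 2W²a·F̄)` with confidence `1 − e^{−na}`
— both radii data-driven, the weight level `W²` entering linearly (Hoeffding: `W²√(a/2)`).  Since
`ESS = 1/M₂` is monotone, these are certified bounds for the ESS column, and two codes' ESS
columns compare through `F̄ − F̄'` with no density parity between them.  NEW WORK of the cell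
(elementary); cited facts BLM 2013 Ex. 2.9 / eq. (2.10), proved in the tree; no definition.

## What is proved (setting: `(Ω,P)` probability space; `(X,μ)`; `p ≥ 0` normalised, `q > 0`
## normalised, `p ≤ Wq`; `yᵢ` independent with law `μ.withDensity q`; `n = #s ≥ 1`)

* `sq_add_sqrt_eq` — for `c, d ≥ 0`, `u = c + √(c² + d)` solves `u² = 2cu + d` (the Bernstein
  inversion); `bernsteinRadius_mono` — the lower radius is monotone in the estimate.
* **`invESS_upper_selfRadius_confidence`** — `a ≥ 0`:
  `P( F̄ + √(2W²aF̄) + 2W²a ≤ M₂ ) ≤ e^{−na}`.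
* **`invESS_lower_bernsteinRadius_confidence`** — `a > 0`:
  `P( M₂ ≤ F̄ − (W²a/3 + √((W²a/3)² + 2W²aF̄)) ) ≤ e^{−na}`.
* **`invESS_twoSided_confidence`** — the union: probability `≤ 2e^{−na}`.
* **`invESS_AB_confidence`** — two codes `q, q'` (ceilings `W, W'`), own draws (`n, n'`), nothing
  assumed between them: `M₂ − M₂'` leaves the data-driven interval
  `(F̄ − r⁻ − F̄' − r'⁺, F̄ + r⁺ − F̄' + r'⁻)` with probability `≤ 2e^{−na} + 2e^{−n'a'}`.

Reading for row 4 (value-free; no number of ours, no sealed value): a code's reweighting ESS is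
a certified two-sided reading from its own proposals and normalised weights, at confidence set by
`na = log(1/η)` with radii of the order `√(W²·F̄·log(1/η)/n) + W² log(1/η)/n`; the A-vs-B ESS
comparison needs no parity hypothesis.  NOT CLAIMED: unnormalised weights (the printed Kish
fraction is a ratio; cf. `Scoring/PairedDrawAcceptanceRatio` for the analogous treatment of the
acceptance); estimating `W`; optimal constants; the `τ_int` column (needs the chain); any number
re-scored.
-/

noncomputable section

namespace Summit.Ventures.LatticeQCDFlow.Scoring.ModelDrawESS

open MeasureTheory ProbabilityTheory Finset Real Set
open Summit.Ventures.LatticeQCDFlow.Exactness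

variable {Ω : Type*} [MeasurableSpace Ω] {P : Measure Ω} [IsProbabilityMeasure P] {ι : Type*}
variable {X : Type*} [MeasurableSpace X] {μ : Measure X}

/-! ## §1 Deterministic pieces -/

/-- **The Bernstein inversion.**  For `d ≥ 0` (any `c`) the number `u = c + √(c² + d)` satisfies
`u² = 2cu + d` (so with `c = W²a/3`, `d = 2W²a·m`: `u² = 2W²a(m + u/3)`, i.e. Bernstein's exponent
`u²/(2W²(m + u/3))` equals `a`). [ours] -/
theorem sq_add_sqrt_eq {c d : ℝ} (hd : 0 ≤ d) :
    (c + Real.sqrt (c ^ 2 + d)) ^ 2 = 2 * c * (c + Real.sqrt (c ^ 2 + d)) + d := by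
  have h := Real.sq_sqrt (show 0 ≤ c ^ 2 + d by positivity)
  nlinarith [h, Real.sqrt_nonneg (c ^ 2 + d)]

/-- The lower (Bernstein) radius `m ↦ c + √(c² + k·m)` is monotone in the estimate `m` (`k ≥ 0`).
[ours] -/
theorem bernsteinRadius_mono {c k m m' : ℝ} (hk : 0 ≤ k) (h : m ≤ m') :
    c + Real.sqrt (c ^ 2 + k * m) ≤ c + Real.sqrt (c ^ 2 + k * m') := by
  have : c ^ 2 + k * m ≤ c ^ 2 + k * m' := by nlinarith
  linarith [Real.sqrt_le_sqrt this]

omit [MeasurableSpace X] in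
/-- `(p/q)² ∈ [0, W²]` under `0 ≤ p ≤ Wq`, `q > 0`. [folklore] -/
private theorem sqWeight_mem_Icc {p q : X → ℝ} (hp0 : ∀ y, 0 ≤ p y) (hq0 : ∀ y, 0 < q y) {W : ℝ}
    (hW : ∀ y, p y ≤ W * q y) (y : X) : (p y / q y) ^ 2 ∈ Icc (0 : ℝ) (W ^ 2) := by
  have hr : p y / q y ≤ W := by rw [div_le_iff₀ (hq0 y)]; exact hW y
  exact ⟨sq_nonneg _, pow_le_pow_left₀ (div_nonneg (hp0 y) (hq0 y).le) hr 2⟩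

/-- `∫ (p/q)²·q dμ = ∫ p²/q dμ` (`q > 0`). [folklore] -/
private theorem integral_sqWeight_mul {p q : X → ℝ} (hq0 : ∀ y, 0 < q y) :
    ∫ y, (p y / q y) ^ 2 * q y ∂μ = ∫ y, p y ^ 2 / q y ∂μ := by
  refine integral_congr_ae (Filter.Eventually.of_forall fun y => ?_)
  field_simp [(hq0 y).ne']

/-- A weight ceiling over a normalised `p` forces `W > 0`. [folklore] -/
private theorem weightLevel_pos' {p q : X → ℝ} (hp0 : ∀ y, 0 ≤ p y) (hp1 : ∫ y, p y ∂μ = 1)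
    (hq0 : ∀ y, 0 < q y) {W : ℝ} (hW : ∀ y, p y ≤ W * q y) : 0 < W := by
  by_contra hW0
  have hp : ∀ y, p y = 0 := fun y => le_antisymm
    ((hW y).trans (mul_nonpos_of_nonpos_of_nonneg (not_lt.mp hW0) (hq0 y).le)) (hp0 y)
  simp [hp] at hp1

/-! ## §2 `1/ESS` from above: the self-bounded radius -/

/-- **`1/ESS` FROM ABOVE (ESS from below).**  Independent model draws `yᵢ` (`i ∈ s`, `n = #s ≥ 1`),
normalised `p ≥ 0` with ceiling `p ≤ Wq`, `F̄ = (1/n) Σ (p(yᵢ)/q(yᵢ))²`, `M₂ = ∫ p²/q dμ`; for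
`a ≥ 0`: `P( F̄ + √(2W²a·F̄) + 2W²a ≤ M₂ ) ≤ e^{−na}`. [ours] -/
theorem invESS_upper_selfRadius_confidence {y : ι → Ω → X} (hind : iIndepFun y P)
    (hym : ∀ i, Measurable (y i)) {p q : X → ℝ} (hp0 : ∀ z, 0 ≤ p z) (hpm : Measurable p)
    (hp1 : ∫ z, p z ∂μ = 1) (hq0 : ∀ z, 0 < q z) (hqm : Measurable q) {W : ℝ}
    (hW : ∀ z, p z ≤ W * q z)
    (hlaw : ∀ i, Measure.map (y i) P = μ.withDensity fun z => ENNReal.ofReal (q z)) {a : ℝ}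
    (ha : 0 ≤ a) (s : Finset ι) (hs : 0 < s.card) :
    P.real {ω | (∑ i ∈ s, (p (y i ω) / q (y i ω)) ^ 2) / s.card
          + Real.sqrt (2 * (W ^ 2 * a) * ((∑ i ∈ s, (p (y i ω) / q (y i ω)) ^ 2) / s.card))
          + 2 * (W ^ 2 * a)
        ≤ ∫ z, p z ^ 2 / q z ∂μ}
      ≤ Real.exp (-(s.card * a)) := by
  have hWpos : 0 < W := weightLevel_pos' hp0 hp1 hq0 hW
  have h := ParityLeg.measureReal_mean_add_selfRadius_le_exp_of_model_draws hind hym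
    (fun z => (hq0 z).le) hqm hlaw (F := fun z => (p z / q z) ^ 2) ((hpm.div hqm).pow_const 2)
    (pow_pos hWpos 2) (sqWeight_mem_Icc hp0 hq0 hW) ha s hs
  rw [integral_sqWeight_mul hq0] at h
  exact h

/-! ## §3 `1/ESS` from below: Bernstein with the self-bounding variance proxy, inverted -/

/-- **`1/ESS` FROM BELOW (ESS from above).**  Same setting with `q` normalised and `p` integrable;
for `a > 0`, writing `c = W²a/3`:
`P( M₂ ≤ F̄ − (c + √(c² + 2W²a·F̄)) ) ≤ e^{−na}`
(Bernstein for the scores `w(yᵢ)² ≤ W²` with variance proxy `E w⁴ ≤ W²M₂`, at the deviation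
`u = c + √(c² + 2W²aM₂)` where its exponent is exactly `a`; then monotonicity of the radius turns
the oracle event into the empirical one). [ours] -/
theorem invESS_lower_bernsteinRadius_confidence [SFinite μ] {y : ι → Ω → X}
    (hind : iIndepFun y P) (hym : ∀ i, Measurable (y i)) {p q : X → ℝ} (hp0 : ∀ z, 0 ≤ p z)
    (hpm : Measurable p) (hpi : Integrable p μ) (hp1 : ∫ z, p z ∂μ = 1) (hq0 : ∀ z, 0 < q z)
    (hqm : Measurable q) (hqi : Integrable q μ) (hq1 : ∫ z, q z ∂μ = 1) {W : ℝ}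
    (hW : ∀ z, p z ≤ W * q z)
    (hlaw : ∀ i, Measure.map (y i) P = μ.withDensity fun z => ENNReal.ofReal (q z)) {a : ℝ}
    (ha : 0 < a) (s : Finset ι) (hs : 0 < s.card) :
    P.real {ω | ∫ z, p z ^ 2 / q z ∂μ
        ≤ (∑ i ∈ s, (p (y i ω) / q (y i ω)) ^ 2) / s.card
          - (W ^ 2 * a / 3 + Real.sqrt ((W ^ 2 * a / 3) ^ 2
              + 2 * (W ^ 2 * a) * ((∑ i ∈ s, (p (y i ω) / q (y i ω)) ^ 2) / s.card)))}
      ≤ Real.exp (-(s.card * a)) := by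
  have hWpos : 0 < W := weightLevel_pos' hp0 hp1 hq0 hW
  have hW2 : 0 < W ^ 2 := pow_pos hWpos 2
  have hn : (0 : ℝ) < s.card := by exact_mod_cast hs
  set M₂ : ℝ := ∫ z, p z ^ 2 / q z ∂μ with hM₂
  have hI := ParityLeg.integrable_sq_div_of_weightBound hp0 hpm hpi hq0 hqm hW
  have hM1 : 1 ≤ M₂ := TargetSideParityESS.one_le_integral_sq_div hpi hp1 hq0 hqi hq1 hI
  have hM0 : 0 < M₂ := by linarith
  -- the scores `F(yᵢ) = w(yᵢ)²`
  set F : X → ℝ := fun z => (p z / q z) ^ 2 with hF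
  have hFm : Measurable F := (hpm.div hqm).pow_const 2
  have hind' : iIndepFun (fun i ω => F (y i ω)) P := hind.comp (fun _ => F) fun _ => hFm
  have hLp : ∀ i, MemLp (fun ω => F (y i ω)) 2 P := fun i =>
    MemLp.of_bound ((hFm.comp (hym i)).aestronglyMeasurable) (W ^ 2)
      (Filter.Eventually.of_forall fun ω => by
        have h := sqWeight_mem_Icc hp0 hq0 hW (y i ω)
        rw [Real.norm_eq_abs, abs_of_nonneg h.1]; exact h.2)
  have hb : ∀ i, ∀ᵐ ω ∂P, F (y i ω) ≤ W ^ 2 := fun i =>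
    Filter.Eventually.of_forall fun ω => (sqWeight_mem_Icc hp0 hq0 hW (y i ω)).2
  have hmean : ∀ i, ∫ ω, F (y i ω) ∂P = M₂ := fun i => by
    rw [ParityLeg.integral_comp_eq_integral_mul_of_map_eq (hym i) (fun z => (hq0 z).le) hqm
      (hlaw i) hFm, hF, integral_sqWeight_mul hq0]
  have hsq : ∀ i, ∫ ω, F (y i ω) ^ 2 ∂P ≤ W ^ 2 * M₂ := fun i => by
    rw [← hmean i, ← integral_const_mul]
    refine integral_mono (hLp i).integrable_sq (((hLp i).integrable one_le_two).const_mul _)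
      fun ω => ?_
    have h1 := sqWeight_mem_Icc hp0 hq0 hW (y i ω)
    calc F (y i ω) ^ 2 = F (y i ω) * F (y i ω) := sq _
      _ ≤ W ^ 2 * F (y i ω) := mul_le_mul_of_nonneg_right h1.2 h1.1
  -- the oracle deviation `u`
  set c : ℝ := W ^ 2 * a / 3 with hc
  have hc0 : 0 ≤ c := by positivity
  set u : ℝ := c + Real.sqrt (c ^ 2 + 2 * (W ^ 2 * a) * M₂) with hu
  have hu0 : 0 < u := by
    have : 0 < c := by positivity
    have := Real.sqrt_nonneg (c ^ 2 + 2 * (W ^ 2 * a) * M₂)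
    linarith
  have hkey : u ^ 2 = 2 * c * u + 2 * (W ^ 2 * a) * M₂ :=
    sq_add_sqrt_eq (by positivity)
  have hB := Literature.Probability.Moments.measureReal_card_mul_add_le_sum_le_exp_of_sq_le hind'
    hLp hW2 hb (fun i => (hmean i).le) (mul_pos hW2 hM0) hsq s hs hu0
  -- Bernstein's exponent at `u` is exactly `n a`
  have hexp : Real.exp (-(s.card * u ^ 2 / (2 * (W ^ 2 * M₂ + W ^ 2 * u / 3))))
      = Real.exp (-(s.card * a)) := by
    congr 2
    have hden : 0 < 2 * (W ^ 2 * M₂ + W ^ 2 * u / 3) := by positivity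
    rw [div_eq_iff hden.ne', hkey, hc]
    ring
  rw [hexp] at hB
  -- the empirical event implies the oracle event (radius monotone in the estimate)
  refine (measureReal_mono fun ω hω => ?_).trans hB
  simp only [mem_setOf_eq] at hω ⊢
  set m : ℝ := (∑ i ∈ s, F (y i ω)) / s.card with hm
  have hr0 : 0 ≤ c + Real.sqrt (c ^ 2 + 2 * (W ^ 2 * a) * m) := by
    have := Real.sqrt_nonneg (c ^ 2 + 2 * (W ^ 2 * a) * m); linarith
  have hMm : M₂ ≤ m := by linarith
  have hmono := bernsteinRadius_mono (c := c) (k := 2 * (W ^ 2 * a)) (by positivity) hMm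
  have e : ∑ i ∈ s, F (y i ω) = s.card * m := by rw [hm]; field_simp
  rw [e]
  have : M₂ + u ≤ m := by rw [hu]; linarith
  exact mul_le_mul_of_nonneg_left this hn.le

/-! ## §4 Two-sided, and A-vs-B -/

/-- **TWO-SIDED CERTIFICATE FOR `1/ESS`.**  Under the hypotheses of the two previous theorems
(`a > 0`): with `r⁺ = √(2W²aF̄) + 2W²a` and `r⁻ = W²a/3 + √((W²a/3)² + 2W²aF̄)`,
`P( F̄ + r⁺ ≤ M₂  ∨  M₂ ≤ F̄ − r⁻ ) ≤ 2e^{−na}` — i.e. `1/ESS ∈ (F̄ − r⁻, F̄ + r⁺)` (so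
`ESS ∈ (1/(F̄ + r⁺), 1/(F̄ − r⁻))` when `F̄ > r⁻`) with confidence `1 − 2e^{−na}`. [ours] -/
theorem invESS_twoSided_confidence [SFinite μ] {y : ι → Ω → X} (hind : iIndepFun y P)
    (hym : ∀ i, Measurable (y i)) {p q : X → ℝ} (hp0 : ∀ z, 0 ≤ p z) (hpm : Measurable p)
    (hpi : Integrable p μ) (hp1 : ∫ z, p z ∂μ = 1) (hq0 : ∀ z, 0 < q z) (hqm : Measurable q)
    (hqi : Integrable q μ) (hq1 : ∫ z, q z ∂μ = 1) {W : ℝ} (hW : ∀ z, p z ≤ W * q z)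
    (hlaw : ∀ i, Measure.map (y i) P = μ.withDensity fun z => ENNReal.ofReal (q z)) {a : ℝ}
    (ha : 0 < a) (s : Finset ι) (hs : 0 < s.card) :
    P.real {ω | (∑ i ∈ s, (p (y i ω) / q (y i ω)) ^ 2) / s.card
            + Real.sqrt (2 * (W ^ 2 * a) * ((∑ i ∈ s, (p (y i ω) / q (y i ω)) ^ 2) / s.card))
            + 2 * (W ^ 2 * a) ≤ ∫ z, p z ^ 2 / q z ∂μ
          ∨ ∫ z, p z ^ 2 / q z ∂μ
            ≤ (∑ i ∈ s, (p (y i ω) / q (y i ω)) ^ 2) / s.card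
              - (W ^ 2 * a / 3 + Real.sqrt ((W ^ 2 * a / 3) ^ 2
                  + 2 * (W ^ 2 * a) * ((∑ i ∈ s, (p (y i ω) / q (y i ω)) ^ 2) / s.card)))}
      ≤ 2 * Real.exp (-(s.card * a)) := by
  have h1 := invESS_upper_selfRadius_confidence hind hym hp0 hpm hp1 hq0 hqm hW hlaw ha.le s hs
  have h2 := invESS_lower_bernsteinRadius_confidence hind hym hp0 hpm hpi hp1 hq0 hqm hqi hq1 hW
    hlaw ha s hs
  rw [Set.setOf_or]
  refine (measureReal_union_le _ _).trans ?_
  calc _ ≤ Real.exp (-(s.card * a)) + Real.exp (-(s.card * a)) := add_le_add h1 h2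
    _ = 2 * Real.exp (-(s.card * a)) := by ring

/-- **A-vs-B FOR THE ESS COLUMN, NO PARITY HYPOTHESIS.**  One normalised target `p`; two
normalised models `q, q' > 0` with ceilings `p ≤ Wq`, `p ≤ W'q'`; code A's draws `yᵢ ~ q`
(`i ∈ s`, `n ≥ 1`, estimate `F̄`, radii `r⁺, r⁻` at level `a > 0`), code B's draws `y'ⱼ ~ q'`
(`j ∈ s'`, `n' ≥ 1`, `F̄'`, `r'⁺, r'⁻` at `a' > 0`), nothing assumed between them.  Then
`M₂ − M₂'` (`= 1/ESS − 1/ESS'`) lies outside the data-driven interval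
`(F̄ − r⁻ − (F̄' + r'⁺), F̄ + r⁺ − (F̄' − r'⁻))` with probability `≤ 2e^{−na} + 2e^{−n'a'}`. [ours] -/
theorem invESS_AB_confidence [SFinite μ] {p q q' : X → ℝ} (hp0 : ∀ z, 0 ≤ p z)
    (hpm : Measurable p) (hpi : Integrable p μ) (hp1 : ∫ z, p z ∂μ = 1) (hq0 : ∀ z, 0 < q z)
    (hqm : Measurable q) (hqi : Integrable q μ) (hq1 : ∫ z, q z ∂μ = 1) (hq0' : ∀ z, 0 < q' z)
    (hqm' : Measurable q') (hqi' : Integrable q' μ) (hq1' : ∫ z, q' z ∂μ = 1) {W W' : ℝ}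
    (hW : ∀ z, p z ≤ W * q z) (hW' : ∀ z, p z ≤ W' * q' z) {y : ι → Ω → X}
    (hind : iIndepFun y P) (hym : ∀ i, Measurable (y i))
    (hlaw : ∀ i, Measure.map (y i) P = μ.withDensity fun z => ENNReal.ofReal (q z))
    {ι' : Type*} {y' : ι' → Ω → X} (hind' : iIndepFun y' P) (hym' : ∀ j, Measurable (y' j))
    (hlaw' : ∀ j, Measure.map (y' j) P = μ.withDensity fun z => ENNReal.ofReal (q' z))
    (s : Finset ι) (s' : Finset ι') (hs : 0 < s.card) (hs' : 0 < s'.card) {a a' : ℝ}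
    (ha : 0 < a) (ha' : 0 < a') :
    P.real {ω |
        ((∑ i ∈ s, (p (y i ω) / q (y i ω)) ^ 2) / s.card
            + Real.sqrt (2 * (W ^ 2 * a) * ((∑ i ∈ s, (p (y i ω) / q (y i ω)) ^ 2) / s.card))
            + 2 * (W ^ 2 * a))
          - ((∑ j ∈ s', (p (y' j ω) / q' (y' j ω)) ^ 2) / s'.card
            - (W' ^ 2 * a' / 3 + Real.sqrt ((W' ^ 2 * a' / 3) ^ 2
                + 2 * (W' ^ 2 * a') * ((∑ j ∈ s', (p (y' j ω) / q' (y' j ω)) ^ 2) / s'.card))))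
          ≤ (∫ z, p z ^ 2 / q z ∂μ) - ∫ z, p z ^ 2 / q' z ∂μ
        ∨ (∫ z, p z ^ 2 / q z ∂μ) - ∫ z, p z ^ 2 / q' z ∂μ
          ≤ ((∑ i ∈ s, (p (y i ω) / q (y i ω)) ^ 2) / s.card
              - (W ^ 2 * a / 3 + Real.sqrt ((W ^ 2 * a / 3) ^ 2
                  + 2 * (W ^ 2 * a) * ((∑ i ∈ s, (p (y i ω) / q (y i ω)) ^ 2) / s.card))))
            - ((∑ j ∈ s', (p (y' j ω) / q' (y' j ω)) ^ 2) / s'.card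
              + Real.sqrt (2 * (W' ^ 2 * a')
                  * ((∑ j ∈ s', (p (y' j ω) / q' (y' j ω)) ^ 2) / s'.card))
              + 2 * (W' ^ 2 * a'))}
      ≤ 2 * Real.exp (-(s.card * a)) + 2 * Real.exp (-(s'.card * a')) := by
  have hA := invESS_twoSided_confidence hind hym hp0 hpm hpi hp1 hq0 hqm hqi hq1 hW hlaw ha s hs
  have hB := invESS_twoSided_confidence hind' hym' hp0 hpm hpi hp1 hq0' hqm' hqi' hq1' hW' hlaw'
    ha' s' hs'
  refine (measureReal_mono fun ω hω => ?_).trans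
    ((measureReal_union_le {ω | (∑ i ∈ s, (p (y i ω) / q (y i ω)) ^ 2) / s.card
            + Real.sqrt (2 * (W ^ 2 * a) * ((∑ i ∈ s, (p (y i ω) / q (y i ω)) ^ 2) / s.card))
            + 2 * (W ^ 2 * a) ≤ ∫ z, p z ^ 2 / q z ∂μ
          ∨ ∫ z, p z ^ 2 / q z ∂μ
            ≤ (∑ i ∈ s, (p (y i ω) / q (y i ω)) ^ 2) / s.card
              - (W ^ 2 * a / 3 + Real.sqrt ((W ^ 2 * a / 3) ^ 2
                + 2 * (W ^ 2 * a) * ((∑ i ∈ s, (p (y i ω) / q (y i ω)) ^ 2) / s.card)))}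
      {ω | (∑ j ∈ s', (p (y' j ω) / q' (y' j ω)) ^ 2) / s'.card
            + Real.sqrt (2 * (W' ^ 2 * a') * ((∑ j ∈ s', (p (y' j ω) / q' (y' j ω)) ^ 2) / s'.card))
            + 2 * (W' ^ 2 * a') ≤ ∫ z, p z ^ 2 / q' z ∂μ
          ∨ ∫ z, p z ^ 2 / q' z ∂μ
            ≤ (∑ j ∈ s', (p (y' j ω) / q' (y' j ω)) ^ 2) / s'.card
              - (W' ^ 2 * a' / 3 + Real.sqrt ((W' ^ 2 * a' / 3) ^ 2
                + 2 * (W' ^ 2 * a') * ((∑ j ∈ s', (p (y' j ω) / q' (y' j ω)) ^ 2) / s'.card)))}).trans (add_le_add hA hB))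
  simp only [mem_setOf_eq, mem_union] at hω ⊢
  by_contra hcon
  simp only [not_or, not_le] at hcon
  obtain ⟨⟨h1, h2⟩, h3, h4⟩ := hcon
  rcases hω with h | h <;> linarith

end Summit.Ventures.LatticeQCDFlow.Scoring.ModelDrawESS

end
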